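import Summits.Ventures.Crystal3D.Theorems.StickyWulffConstantTextureLiminfTexShadowVocabularyV5
import Summits.Ventures.Crystal3D.Theorems.StickyWulffConstantLiminfAssemblyOfV5
import HarnessLib

/-!
# Split v5 — MONOTONICITY IN THE LAW between the v4 items (law `(1, ½)`) and the v5 items (law `(13/25, ½)`)

Route `StickyWulffConstant` of the venture `Summits/Ventures/Crystal3D` (cell `crystal3d-full`); bookkeeping for the split-v5 items
`GenericWallFloorV5` (stmt-Ventures-23910), `PolycrystalWulffBoundV5` (stmt-Ventures-23911), `TextureLiminfV5` (stmt-Ventures-23912)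
against their v4 parents (19480 / 19482 / 19483), which stay open as the strong forms (cf-p1 (lxxii)).  Pure bookkeeping, standard axioms;
no item is closed here; rung F-C1 not moved.

* G: `genericWallFloorV5_of_genericWallFloor : GenericWallFloor → GenericWallFloorV5` (charge `1 ≥ 13/25`: closing 19480 closes 23910);
* P: `polycrystalWulffBound_iff_tex`, `polycrystalWulffBoundV5_iff_tex` (`Iff.rfl`: the two route items in the texture vocabulary
  `IsTexture c₀ ½ / vol / energy` of `…TexShadowVocabulary`), `isTexture_anti` (a texture for a larger law is a texture for a smaller one),
  `polycrystalWulffBound_of_v5 : PolycrystalWulffBoundV5 → PolycrystalWulffBound` (the v5 bound quantifies over MORE textures: closing 23911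
  closes 19482);
* T: no implication either way (`TextureLiminfV5` has the weaker hypothesis `GenericWallFloorV5` AND the weaker conclusion); the two are
  tied to `LiminfAssembly` separately (`textureLiminf_iff_liminfAssembly`, `textureLiminfV5_iff_liminfAssembly`).
WHAT THIS IS NOT: no proof of any item; F-C1 not moved.
-/

noncomputable section

namespace Summit.Ventures.Crystal3D.Cruxes.TextureLiminf.TexShadow

open MeasureTheory Set Filter
open scoped RealInnerProductSpace ENNReal Pointwise
open Summit.Ventures.Crystal3D Summit.Ventures.Crystal3D.Theorems

/-! ## G: the v4 wall floor gives the v5 one -/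

/-- **`GenericWallFloor → GenericWallFloorV5`** (the deficiency-form cell with charge `1` implies it with charge `13/25`). -/
theorem genericWallFloorV5_of_genericWallFloor
    (h : Summit.Ventures.Crystal3D.Theses.StickyWulffConstant.GenericWallFloor) :
    Summit.Ventures.Crystal3D.Theses.StickyWulffConstant.GenericWallFloorV5 := by
  rw [genericWallFloorV5_iff_atCharge]
  intro A₁ t₁ A₂ t₂ hnc
  exact genericWallFloorAtCharge_mono (by norm_num) ((genericWallFloor_iff_at.1 h) A₁ t₁ A₂ t₂ hnc)

/-! ## P: the v5 polycrystal Wulff bound gives the v4 one -/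

/-- The ROUTE item `PolycrystalWulffBound` (stmt-Ventures-19482, law `(1, ½)`) in the texture vocabulary (definitional). -/
theorem polycrystalWulffBound_iff_tex :
    Summit.Ventures.Crystal3D.Theses.StickyWulffConstant.PolycrystalWulffBound ↔
      ∀ (n : ℕ) (G : Fin n → Set E3) (A : Fin n → (E3 ≃ₗᵢ[ℝ] E3)) (c : Fin n → Fin n → ℝ) (m : Fin n → Fin n → E3),
        IsTexture 1 (1 / 2) n G A c m → 6 * (2 : ℝ) ^ ((1 : ℝ) / 3) * (Real.sqrt 2 * vol n G) ^ ((2 : ℝ) / 3) ≤ energy n G A c m :=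
  Iff.rfl

/-- The ROUTE item `PolycrystalWulffBoundV5` (stmt-Ventures-23911, law `(13/25, ½)`) in the texture vocabulary (definitional). -/
theorem polycrystalWulffBoundV5_iff_tex :
    Summit.Ventures.Crystal3D.Theses.StickyWulffConstant.PolycrystalWulffBoundV5 ↔
      ∀ (n : ℕ) (G : Fin n → Set E3) (A : Fin n → (E3 ≃ₗᵢ[ℝ] E3)) (c : Fin n → Fin n → ℝ) (m : Fin n → Fin n → E3),
        IsTexture (13 / 25) (1 / 2) n G A c m →
          6 * (2 : ℝ) ^ ((1 : ℝ) / 3) * (Real.sqrt 2 * vol n G) ^ ((2 : ℝ) / 3) ≤ energy n G A c m :=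
  Iff.rfl

/-- **A texture for a larger law is a texture for a smaller law** (`IsTexture` is antitone in `(c₀, c₁)`: the charge floors only drop). -/
theorem isTexture_anti {c₀ c₀' c₁ c₁' : ℝ} (h₀ : c₀' ≤ c₀) (h₁ : c₁' ≤ c₁) {n : ℕ} {G : Fin n → Set E3}
    {A : Fin n → (E3 ≃ₗᵢ[ℝ] E3)} {c : Fin n → Fin n → ℝ} {m : Fin n → Fin n → E3} (h : IsTexture c₀ c₁ n G A c m) :
    IsTexture c₀' c₁' n G A c m :=
  ⟨h.1, h.2.1, h.2.2.1, fun f g hfg hnc => ⟨(h.2.2.2.1 f g hfg hnc).1, h₀.trans (h.2.2.2.1 f g hfg hnc).2⟩,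
    fun f g hfg hco hne => ⟨(h.2.2.2.2 f g hfg hco hne).1, h₁.trans (h.2.2.2.2 f g hfg hco hne).2⟩⟩

/-- **`PolycrystalWulffBoundV5 → PolycrystalWulffBound`**: the v5 bound quantifies over every `(13/25, ½)`-texture, and a
`(1, ½)`-texture is one (closing stmt-Ventures-23911 closes stmt-Ventures-19482). -/
theorem polycrystalWulffBound_of_v5
    (h : Summit.Ventures.Crystal3D.Theses.StickyWulffConstant.PolycrystalWulffBoundV5) :
    Summit.Ventures.Crystal3D.Theses.StickyWulffConstant.PolycrystalWulffBound := by
  rw [polycrystalWulffBound_iff_tex]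
  intro n G A c m hT
  exact (polycrystalWulffBoundV5_iff_tex.1 h) n G A c m (isTexture_anti (by norm_num) le_rfl hT)

end Summit.Ventures.Crystal3D.Cruxes.TextureLiminf.TexShadow

end
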